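import Literature.Probability.RandomPlanarGeometry.HexSAWBrickWallStripFugacityArches
import HarnessLib

/-!
# BBdGDCG14 Corollary 8, first sentence: the arch, bridge and walk series of the strip `S_T` have the same radius of convergence `1/μ_T(y,z)`

Topic `Literature/Probability/RandomPlanarGeometry` (continues `HexSAWBrickWallStripFugacityArches.lean` — BBdGDCG14
Proposition 6, first clause: `A_{T,2j}(y,z)^{1/(2j)} → μ_T(y,z)`, `B_{T,2j+1}(y,z)^{1/(2j+1)} → μ_T(y,z)`,
`C_{T,n}(y,z)^{1/n} → μ_T(y,z)` for the two-surface partition functions `archZ₂`, `bridgeZ₂`, `stripZ₂` of the brick-wall strip).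

Source.  N. R. Beaton, M. Bousquet-Mélou, J. de Gier, H. Duminil-Copin, A. J. Guttmann, Comm. Math. Phys. 326 (2014),
arXiv:1109.0358v5, §3.2, Corollary 8 (p. 12), first sentence: "Let `y > 0`. The generating functions `A_T(x,y)`, `B_T(x,y)`
and `C_T(x,y)` all have the same radius of convergence, `ρ_T(y) = 1/μ_T(1,y)`", printed proof: "an obvious translation of
Propositions 6 and 7" (for this first sentence Proposition 6 alone suffices; Proposition 7 serves the monotone limit of the
second sentence, not treated here).  Here
the translation is written for both surface weights: for `x > 0` the series `Σ_n A_{T,n}(y,z) xⁿ`, `Σ_n B_{T,n}(y,z) xⁿ`,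
`Σ_n C_{T,n}(y,z) xⁿ` converge when `x μ_T(y,z) < 1` and diverge when `x μ_T(y,z) > 1` (root test on the limits of
`HexSAWBrickWallStripFugacityArches.lean`; the walk series moreover diverges AT `x μ_T(y,z) = 1`, by `C_{T,n} ≥ μ_Tⁿ/K`).

Edition 2 (a-p5 gen 13): lit-1 g18 tokens RD-1/RD-2/RD-3 folded (08:22:37Z) — docstrings only, code verbatim.

## Contents (namespace `Literature.Probability.RandomPlanarGeometry.SAW.HexBW`, all PROVED)

* `summable_stripZ₂_mul_pow`, `summable_archZ₂_mul_pow`, `summable_bridgeZ₂_mul_pow` — convergence for `x μ_T(y,z) < 1`;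
* `not_summable_stripZ₂_mul_pow` (`1 ≤ x μ_T`), `not_summable_archZ₂_mul_pow`, `not_summable_bridgeZ₂_mul_pow` (`1 < x μ_T`);
* `summable_archZ₂_mul_pow_iff_of_ne`, `summable_bridgeZ₂_mul_pow_iff_of_ne` — off the critical circle, the three series
  converge or diverge together: Corollary 8, sentence 1.
-/

noncomputable section

open Filter Topology Finset Literature.Probability.LatticeModels Literature.Probability.Percolation SimpleGraph

namespace Literature.Probability.RandomPlanarGeometry.SAW.HexBW

variable {T : ℕ} {x y z : ℝ}

/-! ### Convergence below `1/μ_T(y,z)` -/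

/-- If `a_n ≥ 0` and `a_{φ j}^{1/φ j} → μ` along an index map `φ` with `φ j → ∞`, and `x μ < 1`, then eventually
`a_{φ j} x^{φ j} ≤ r^{φ j}` for some `r < 1`; here in the form used below: **root test along the full sequence** for the walk
series. `Σ_n C_{T,n}(y,z) xⁿ < ∞` for `0 ≤ x`, `x μ_T(y,z) < 1`.
[cite: BeatonBousquetMelouDeGierDuminilCopinGuttmann2014, Corollary 8 (arXiv v5 p. 12: "ρ_T(y) = 1/μ_T(1,y)")] -/
theorem summable_stripZ₂_mul_pow (T : ℕ) (hy : 0 < y) (hz : 0 < z) (hx : 0 ≤ x) (hlt : x * stripMuY₂ T y z < 1) :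
    Summable (fun n : ℕ => stripZ₂ T n y z * x ^ n) := by
  set μ := stripMuY₂ T y z with hμ
  have hμ0 : 0 < μ := stripMuY₂_pos T hy hz
  -- pick `r` with `x μ < r < 1`
  obtain ⟨r, hr1, hr2⟩ := exists_between hlt
  have hr0 : 0 < r := lt_of_le_of_lt (mul_nonneg hx hμ0.le) hr1
  -- eventually `C_n^{1/n} < r / x`-type bound: use `x · C_n^{1/n} → x μ < r`
  have hlim : Tendsto (fun n : ℕ => x * stripZ₂ T n y z ^ (1 / (n : ℝ))) atTop (𝓝 (x * μ)) :=
    (tendsto_stripZ₂_rpow T hy hz).const_mul x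
  have hev : ∀ᶠ n : ℕ in atTop, stripZ₂ T n y z * x ^ n ≤ r ^ n := by
    filter_upwards [hlim.eventually (gt_mem_nhds hr1), eventually_ge_atTop 1] with n hn hn1
    have hC0 : 0 ≤ stripZ₂ T n y z := (stripZ₂_pos T n hy hz).le
    have h1 : 0 ≤ x * stripZ₂ T n y z ^ (1 / (n : ℝ)) := mul_nonneg hx (Real.rpow_nonneg hC0 _)
    have h2 : (x * stripZ₂ T n y z ^ (1 / (n : ℝ))) ^ n ≤ r ^ n := pow_le_pow_left₀ h1 hn.le n
    have hn0 : (n : ℝ) ≠ 0 := by exact_mod_cast (show n ≠ 0 by omega)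
    rw [mul_pow, ← Real.rpow_natCast (stripZ₂ T n y z ^ (1 / (n : ℝ))), ← Real.rpow_mul hC0,
      one_div_mul_cancel hn0, Real.rpow_one] at h2
    linarith [h2]
  refine Summable.of_norm_bounded_eventually_nat (summable_geometric_of_lt_one hr0.le hr2) ?_
  filter_upwards [hev] with n hn
  rw [Real.norm_of_nonneg (mul_nonneg (stripZ₂_pos T n hy hz).le (pow_nonneg hx n))]
  exact hn

/-- **Arches: `Σ_n A_{T,n}(y,z) xⁿ < ∞` for `0 ≤ x`, `x μ_T(y,z) < 1`** (comparison with the walk series).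
[cite: BeatonBousquetMelouDeGierDuminilCopinGuttmann2014, Corollary 8 (arXiv v5 p. 12)] -/
theorem summable_archZ₂_mul_pow (T : ℕ) (hy : 0 < y) (hz : 0 < z) (hx : 0 ≤ x) (hlt : x * stripMuY₂ T y z < 1) :
    Summable (fun n : ℕ => archZ₂ T n y z * x ^ n) := by
  refine Summable.of_nonneg_of_le (fun n => mul_nonneg (archZ₂_nonneg T n hy.le hz.le) (pow_nonneg hx n))
    (fun n => ?_) (summable_stripZ₂_mul_pow T hy hz hx hlt)
  exact mul_le_mul_of_nonneg_right (archZ₂_le_stripZ₂ T n hy.le hz.le) (pow_nonneg hx n)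

/-- **Bridges: `Σ_n B_{T,n}(y,z) xⁿ < ∞` for `0 ≤ x`, `x μ_T(y,z) < 1`.**
[cite: BeatonBousquetMelouDeGierDuminilCopinGuttmann2014, Corollary 8 (arXiv v5 p. 12)] -/
theorem summable_bridgeZ₂_mul_pow (T : ℕ) (hy : 0 < y) (hz : 0 < z) (hx : 0 ≤ x) (hlt : x * stripMuY₂ T y z < 1) :
    Summable (fun n : ℕ => bridgeZ₂ T n y z * x ^ n) := by
  refine Summable.of_nonneg_of_le (fun n => mul_nonneg (bridgeZ₂_nonneg T n hy.le hz.le) (pow_nonneg hx n))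
    (fun n => ?_) (summable_stripZ₂_mul_pow T hy hz hx hlt)
  exact mul_le_mul_of_nonneg_right (bridgeZ₂_le_stripZ₂ T n hy.le hz.le) (pow_nonneg hx n)

/-! ### Divergence above (and, for walks, at) `1/μ_T(y,z)` -/

/-- **Walks: `Σ_n C_{T,n}(y,z) xⁿ = ∞` for `x μ_T(y,z) ≥ 1`**, `x ≥ 0` — the terms do not tend to `0`, since
`C_{T,n}(y,z) ≥ μ_T(y,z)ⁿ / (max(1,y⁻¹) max(1,z⁻¹))` (submultiplicativity; divergence AT the radius included).
[cite: BeatonBousquetMelouDeGierDuminilCopinGuttmann2014, Corollary 8 (arXiv v5 p. 12) and footnote 5 (arXiv v5 p. 11: "a simple argument proving the divergence at their radius of convergence of generating functions that count SAWs in a strip"); MadrasSlade1993, §1.2, eq. (1.2.10) (p. 10: μ^N ≤ c_N)] -/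
theorem not_summable_stripZ₂_mul_pow (T : ℕ) (hy : 0 < y) (hz : 0 < z) (hx : 0 ≤ x) (hge : 1 ≤ x * stripMuY₂ T y z) :
    ¬ Summable (fun n : ℕ => stripZ₂ T n y z * x ^ n) := by
  intro hs
  have h0 := hs.tendsto_atTop_zero
  set K := yK y * yK z with hK
  have hK1 : 1 ≤ K := by rw [hK]; nlinarith [one_le_yK y, one_le_yK z]
  have hK0 : 0 < K := by linarith
  -- every term with `n ≥ 1` is at least `1/K`
  have hlow : ∀ n : ℕ, 1 ≤ n → K⁻¹ ≤ stripZ₂ T n y z * x ^ n := by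
    intro n hn
    have h1 := stripMuY₂_pow_le T hy hz (m := n) (by omega)
    rw [← hK] at h1
    have h2 : (1 : ℝ) ≤ (x * stripMuY₂ T y z) ^ n := one_le_pow₀ hge
    rw [mul_pow] at h2
    have h3 : 1 ≤ x ^ n * (K * stripZ₂ T n y z) := h2.trans (mul_le_mul_of_nonneg_left h1 (pow_nonneg hx n))
    rw [inv_le_iff_one_le_mul₀ hK0]
    linarith [h3]
  have hev := h0.eventually (gt_mem_nhds (inv_pos.2 hK0))
  obtain ⟨N, hN⟩ := (hev.and (eventually_ge_atTop 1)).exists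
  exact absurd (hlow N hN.2) (not_le.2 hN.1)

/-- Divergence from a subsequence limit: if `a_n ≥ 0`, `a_{φ j}^{1/φ j} → μ` with `φ j → ∞`, and `1 < x μ`, then `Σ a_n xⁿ`
diverges (the terms `a_{φ j} x^{φ j} ≥ 1` eventually). [cite: BeatonBousquetMelouDeGierDuminilCopinGuttmann2014, Corollary 8 (arXiv v5 p. 12)] -/
theorem not_summable_of_rpow_tendsto {a : ℕ → ℝ} {φ : ℕ → ℕ} {μ : ℝ} (ha : ∀ n, 0 ≤ a n)
    (hφ : Tendsto φ atTop atTop) (hlim : Tendsto (fun j => a (φ j) ^ (1 / ((φ j : ℕ) : ℝ))) atTop (𝓝 μ))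
    (hx : 0 ≤ x) (hgt : 1 < x * μ) : ¬ Summable (fun n : ℕ => a n * x ^ n) := by
  intro hs
  have h0 : Tendsto (fun j => a (φ j) * x ^ (φ j)) atTop (𝓝 0) := hs.tendsto_atTop_zero.comp hφ
  have hlim' : Tendsto (fun j => x * a (φ j) ^ (1 / ((φ j : ℕ) : ℝ))) atTop (𝓝 (x * μ)) := hlim.const_mul x
  have hev1 := hlim'.eventually (lt_mem_nhds hgt)
  have hev2 := hφ.eventually (eventually_ge_atTop 1)
  have hev3 := h0.eventually (gt_mem_nhds one_pos)
  obtain ⟨j, ⟨hj1, hj2⟩, hj3⟩ := ((hev1.and hev2).and hev3).exists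
  have hC0 : 0 ≤ a (φ j) := ha _
  have h1 : 0 ≤ x * a (φ j) ^ (1 / ((φ j : ℕ) : ℝ)) := mul_nonneg hx (Real.rpow_nonneg hC0 _)
  have h2 : (1 : ℝ) ^ (φ j) ≤ (x * a (φ j) ^ (1 / ((φ j : ℕ) : ℝ))) ^ (φ j) := pow_le_pow_left₀ zero_le_one hj1.le _
  have hn0 : ((φ j : ℕ) : ℝ) ≠ 0 := by exact_mod_cast (show φ j ≠ 0 by omega)
  rw [one_pow, mul_pow, ← Real.rpow_natCast (a (φ j) ^ (1 / ((φ j : ℕ) : ℝ))), ← Real.rpow_mul hC0,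
    one_div_mul_cancel hn0, Real.rpow_one] at h2
  linarith

/-- **Arches: `Σ_n A_{T,n}(y,z) xⁿ = ∞` for `x μ_T(y,z) > 1`, `x ≥ 0`.** [cite: BeatonBousquetMelouDeGierDuminilCopinGuttmann2014, Corollary 8 (arXiv v5 p. 12)] -/
theorem not_summable_archZ₂_mul_pow (T : ℕ) (hy : 0 < y) (hz : 0 < z) (hx : 0 ≤ x) (hgt : 1 < x * stripMuY₂ T y z) :
    ¬ Summable (fun n : ℕ => archZ₂ T n y z * x ^ n) :=
  not_summable_of_rpow_tendsto (φ := fun j => 2 * j) (fun n => archZ₂_nonneg T n hy.le hz.le)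
    (Filter.tendsto_atTop_atTop.2 fun b => ⟨b, fun j hj => by omega⟩) (tendsto_archZ₂_rpow T hy hz) hx hgt

/-- **Bridges: `Σ_n B_{T,n}(y,z) xⁿ = ∞` for `x μ_T(y,z) > 1`, `x ≥ 0`.** [cite: BeatonBousquetMelouDeGierDuminilCopinGuttmann2014, Corollary 8 (arXiv v5 p. 12)] -/
theorem not_summable_bridgeZ₂_mul_pow (T : ℕ) (hy : 0 < y) (hz : 0 < z) (hx : 0 ≤ x)
    (hgt : 1 < x * stripMuY₂ T y z) : ¬ Summable (fun n : ℕ => bridgeZ₂ T n y z * x ^ n) :=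
  not_summable_of_rpow_tendsto (φ := fun j => 2 * j + 1) (fun n => bridgeZ₂_nonneg T n hy.le hz.le)
    (Filter.tendsto_atTop_atTop.2 fun b => ⟨b, fun j hj => by omega⟩) (tendsto_bridgeZ₂_rpow T hy hz) hx hgt

/-! ### Corollary 8, sentence 1: one radius of convergence `ρ_T(y,z) = 1/μ_T(y,z)` for the three series -/

/-- **The arch series and the walk series converge or diverge together** off the critical circle `x μ_T(y,z) = 1`
(`x ≥ 0`): both converge iff `x μ_T(y,z) < 1`. [cite: BeatonBousquetMelouDeGierDuminilCopinGuttmann2014, Corollary 8, sentence 1 (arXiv v5 p. 12: "all have the same radius of convergence, ρ_T(y) = 1/μ_T(1,y)")] -/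
theorem summable_archZ₂_mul_pow_iff_of_ne (T : ℕ) (hy : 0 < y) (hz : 0 < z) (hx : 0 ≤ x)
    (hne : x * stripMuY₂ T y z ≠ 1) :
    Summable (fun n : ℕ => archZ₂ T n y z * x ^ n) ↔ x * stripMuY₂ T y z < 1 := by
  rcases lt_or_gt_of_ne hne with h | h
  · exact ⟨fun _ => h, fun _ => summable_archZ₂_mul_pow T hy hz hx h⟩
  · exact ⟨fun hs => absurd hs (not_summable_archZ₂_mul_pow T hy hz hx h), fun h' => absurd h' (not_lt.2 h.le)⟩

/-- **The bridge series and the walk series converge or diverge together** off the critical circle.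
[cite: BeatonBousquetMelouDeGierDuminilCopinGuttmann2014, Corollary 8, sentence 1 (arXiv v5 p. 12)] -/
theorem summable_bridgeZ₂_mul_pow_iff_of_ne (T : ℕ) (hy : 0 < y) (hz : 0 < z) (hx : 0 ≤ x)
    (hne : x * stripMuY₂ T y z ≠ 1) :
    Summable (fun n : ℕ => bridgeZ₂ T n y z * x ^ n) ↔ x * stripMuY₂ T y z < 1 := by
  rcases lt_or_gt_of_ne hne with h | h
  · exact ⟨fun _ => h, fun _ => summable_bridgeZ₂_mul_pow T hy hz hx h⟩
  · exact ⟨fun hs => absurd hs (not_summable_bridgeZ₂_mul_pow T hy hz hx h), fun h' => absurd h' (not_lt.2 h.le)⟩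

/-- **The walk series: `Σ_n C_{T,n}(y,z) xⁿ < ∞ ↔ x μ_T(y,z) < 1`** (`x ≥ 0`; divergence AT the radius included).
[cite: BeatonBousquetMelouDeGierDuminilCopinGuttmann2014, Corollary 8, sentence 1 (arXiv v5 p. 12)] -/
theorem summable_stripZ₂_mul_pow_iff (T : ℕ) (hy : 0 < y) (hz : 0 < z) (hx : 0 ≤ x) :
    Summable (fun n : ℕ => stripZ₂ T n y z * x ^ n) ↔ x * stripMuY₂ T y z < 1 :=
  ⟨fun hs => not_le.1 fun h => not_summable_stripZ₂_mul_pow T hy hz hx h hs,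
    fun h => summable_stripZ₂_mul_pow T hy hz hx h⟩

end Literature.Probability.RandomPlanarGeometry.SAW.HexBW
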